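import Summits.NavierStokesRegularity.NavierStokesRegularity.Theses.AngularGalerkinLadder
import Summits.NavierStokesRegularity.NavierStokesRegularity.Theorems.NoOverheating.Negative.RotatedDSSVorticityDirection
import Summits.NavierStokesRegularity.NavierStokesRegularity.Theorems.NoOverheating.Negative.TranslationalSymmetryExcluded
import Literature.Analysis.FluidPDE.GigaMiura2011UnidirectionalVorticityHolds
import Literature.Analysis.FluidPDE.CurlFreeLiouville
import HarnessLib

/-!
# Census stratum (S13): no K2 window profile satisfies the SIGN-FREE (sine-form,
# Constantin–Fefferman / Beirão da Veiga–Berselli) alignment of vorticity directions on the window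
# `(−1, 0)` — single profile, any window, any rotation, no limit

Refuter seat (ns-blowup-refuter g17), kernel census for crux K2 `NoOverheating`
(stmt-NavierStokesRegularity-19960) of route `AngularGalerkinLadder`, Negative lane (`--supports`).
No definition, no named fact, no item verdict moves.

KJ-46 excluded window SEQUENCES all of whose profiles satisfy Giga–Miura's continuous alignment
(CA) in the SIGNED form `‖ξ(x) − ξ(y)‖ ≤ η(‖x − y‖)` (through the Type-I ladder limit and the
signed weak-limit device).  The classical criteria of Constantin–Fefferman 1993 and Beirão da
Veiga–Berselli 2002 (Lemarié-Rieusset 2016, Thm 11.7) are SIGN-FREE: they bound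
`|ξ(x) ∧ ξ(y)| = |sin ∠(ξ(x), ξ(y))|`, so antiparallel vorticity is allowed.  This file closes that
gap for exactly rotated-DSS profiles, with a shorter mechanism and a stronger conclusion:

* §1 the unsigned direction defect `min (‖ξ(x) − ξ(y)‖) (‖ξ(x) + ξ(y)‖)` (`≤ √2 |ξ(x) ∧ ξ(y)|`
  for unit vectors) is transported isometrically across one DSS period exactly like the signed one
  (`unsignedDefect_eq_of_isRotatedDSS`), so the sign-free alignment self-improves under the
  scaling (`sineAlignment_iterate`) and forces, on every window slice `s ∈ (−1, 0)`,
  `ξ(s)(x) = ± ξ(s)(y)` at all points of non-zero vorticity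
  (`vorticityDirection_eq_or_eq_neg_of_sineAlignment`): the slice vorticity is everywhere parallel
  to ONE LINE (`exists_parallel_curl_of_sineAlignment`);
* §2 a rung-profile slice with line-parallel vorticity vanishes identically
  (`rungProfile_slice_eq_zero_of_parallelVorticity`): by Giga–Miura's slice lemma (tree:
  `translationInvariant_of_curl_parallel`) a bounded `C²` divergence-free field whose curl is
  parallel to `e ≠ 0` is invariant along `e`, an irrotational one is constant (harmonic Liouville,
  `eq_of_curl_eq_zero_of_isDivFree_of_bounded`), and Type-I spatial decay kills
  translation-invariant slices (KJ-47, `rungProfile_slice_eq_zero_of_screw_invariant`);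
* §3 for a window profile the zero slice at `s = −1/c²` is carried to `t = −1` by one DSS period,
  against the amplitude floor `‖u(−1, x₀)‖ ≥ δ > 0`: `no_windowProfile_sineAlignment`; the signed
  (CA) for ONE profile is the special case `no_windowProfile_continuousAlignment` (KJ-46 needed the
  whole sequence); §4 the K1 ∧ K2 supply reading.

WHAT ESCAPES (S13): profiles whose vorticity directions fail every modulus at every threshold on
`(−1, 0)` in the sign-free sense too — for an exactly rotated-DSS profile this is the generic case,
since any modulus self-improves to "parallel to a line", which is rigid.  WHAT THIS IS NOT: not
`¬NoOverheating`; nothing here asserts Navier–Stokes regularity or blow-up.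
[cite: ConstantinFefferman1993, §1]
[cite: BeiraodaveigaBerselli2002, Theorem 1.1 (as quoted in Lemarié-Rieusset 2016, Thm 11.7, PDF p. 369)]
[cite: GigaMiura2011, Theorem 1.3 and Remark 1.4 (§1; HUPS preprint #956 p. 4)] -/

noncomputable section

namespace Summit.NavierStokesRegularity.AngularGalerkinLadderSineFormAlignmentExcluded

open Set Function Filter Topology
open Literature.Analysis Literature.Analysis.FluidPDE
open Summit.NavierStokesRegularity.FluidComputer
open Summit.NavierStokesRegularity.FluidComputer.AngularLadder
open Summit.NavierStokesRegularity.NavierStokesRegularity.Theses.AngularGalerkinLadder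
open Summit.NavierStokesRegularity.AngularGalerkinLadderRotatedDSSVorticityDirection
open Summit.NavierStokesRegularity.AngularGalerkinLadderTranslationalSymmetryExcluded

/-! ### §1 The unsigned direction defect under exact rotated discrete self-similarity -/

section Algebra

variable {c : ℝ} {R : EuclideanSpace ℝ (Fin 3) ≃ₗᵢ[ℝ] EuclideanSpace ℝ (Fin 3)}
  {u : ℝ → EuclideanSpace ℝ (Fin 3) → EuclideanSpace ℝ (Fin 3)}

/-- Sums of vorticity directions are transported isometrically across one period,
`‖ξ(s)(x) + ξ(s)(y)‖ = ‖ξ(s/c²)(c⁻¹R⁻¹x) + ξ(s/c²)(c⁻¹R⁻¹y)‖`.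
[cite: ConstantinFefferman1993, §1] -/
theorem norm_vorticityDirection_add_eq_of_isRotatedDSS (h : IsRotatedDSS c R u) (hc : c ≠ 0)
    (s : ℝ) (x y : EuclideanSpace ℝ (Fin 3)) :
    ‖vorticityDirection (curl (u s)) x + vorticityDirection (curl (u s)) y‖ =
      ‖vorticityDirection (curl (u (s / c ^ 2))) (c⁻¹ • R.symm x) +
        vorticityDirection (curl (u (s / c ^ 2))) (c⁻¹ • R.symm y)‖ := by
  rw [vorticityDirection_slice_eq_of_isRotatedDSS h hc s x,
    vorticityDirection_slice_eq_of_isRotatedDSS h hc s y, ← smul_add, ← map_add, norm_smul,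
    LinearIsometryEquiv.norm_map, Real.norm_eq_abs, abs_det_linearIsometryEquiv, one_mul]

/-- **The unsigned (sine-form) direction defect** `min (‖ξ(x) − ξ(y)‖) (‖ξ(x) + ξ(y)‖)` — for unit
vectors at angle `θ` it equals `√(2 − 2|cos θ|) ≤ √2 |sin θ| = √2 |ξ(x) ∧ ξ(y)|` — **is transported
isometrically across one period** (the orientation sign `det R` acts on both vectors at once).
[cite: BeiraodaveigaBerselli2002, Theorem 1.1 (as quoted in Lemarié-Rieusset 2016, Thm 11.7, PDF p. 369)] -/
theorem unsignedDefect_eq_of_isRotatedDSS (h : IsRotatedDSS c R u) (hc : c ≠ 0) (s : ℝ)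
    (x y : EuclideanSpace ℝ (Fin 3)) :
    min ‖vorticityDirection (curl (u s)) x - vorticityDirection (curl (u s)) y‖
        ‖vorticityDirection (curl (u s)) x + vorticityDirection (curl (u s)) y‖ =
      min ‖vorticityDirection (curl (u (s / c ^ 2))) (c⁻¹ • R.symm x) -
            vorticityDirection (curl (u (s / c ^ 2))) (c⁻¹ • R.symm y)‖
          ‖vorticityDirection (curl (u (s / c ^ 2))) (c⁻¹ • R.symm x) +
            vorticityDirection (curl (u (s / c ^ 2))) (c⁻¹ • R.symm y)‖ := by
  rw [norm_vorticityDirection_sub_eq_of_isRotatedDSS h hc s x y,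
    norm_vorticityDirection_add_eq_of_isRotatedDSS h hc s x y]

/-- **Self-improvement of the sign-free alignment under exact rotated DSS** (the unsigned analogue
of KJ-46's `continuousAlignment_iterate`): if on the window `s ∈ (−1, 0)`, above the threshold `d`,
`min (‖ξ(s)(x) − ξ(s)(y)‖) (‖ξ(s)(x) + ξ(s)(y)‖) ≤ η(‖x − y‖)`, then for every `k`, above the
threshold `d/c²ᵏ`, the same defect is at most `η(‖x − y‖/cᵏ)` (pull the pair of points back `k`
periods: magnitudes grow by `c²ᵏ`, distances shrink by `cᵏ`, the defect is unchanged).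
[cite: GigaMiura2011, Theorem 1.3 and Remark 1.4 (§1; HUPS preprint #956 p. 4)] -/
theorem sineAlignment_iterate (h : IsRotatedDSS c R u) (hc : 1 < c) {d : ℝ} {η : ℝ → ℝ}
    (hSA : ∀ s ∈ Ioo (-1 : ℝ) 0, ∀ x y, d < ‖curl (u s) x‖ → d < ‖curl (u s) y‖ →
      min ‖vorticityDirection (curl (u s)) x - vorticityDirection (curl (u s)) y‖
          ‖vorticityDirection (curl (u s)) x + vorticityDirection (curl (u s)) y‖ ≤ η ‖x - y‖)
    (k : ℕ) :
    ∀ s ∈ Ioo (-1 : ℝ) 0, ∀ x y, d < (c ^ 2) ^ k * ‖curl (u s) x‖ →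
      d < (c ^ 2) ^ k * ‖curl (u s) y‖ →
        min ‖vorticityDirection (curl (u s)) x - vorticityDirection (curl (u s)) y‖
            ‖vorticityDirection (curl (u s)) x + vorticityDirection (curl (u s)) y‖ ≤
          η (‖x - y‖ / c ^ k) := by
  have hc0 : c ≠ 0 := (zero_lt_one.trans hc).ne'
  have hcpos : 0 < c := zero_lt_one.trans hc
  induction k with
  | zero =>
    intro s hs x y hx hy
    rw [pow_zero, one_mul] at hx hy
    rw [pow_zero, div_one]
    exact hSA s hs x y hx hy
  | succ k ih =>
    intro s hs x y hx hy
    -- pull back one period: time `s/c²`, points `c⁻¹R⁻¹x`, `c⁻¹R⁻¹y`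
    have hs' : s / c ^ 2 ∈ Ioo (-1 : ℝ) 0 := by
      have hc2 : 1 ≤ c ^ 2 := by nlinarith
      refine ⟨?_, div_neg_of_neg_of_pos hs.2 (by positivity)⟩
      rw [lt_div_iff₀ (by positivity)]
      nlinarith [hs.1]
    have hmag : ∀ z, ‖curl (u (s / c ^ 2)) (c⁻¹ • R.symm z)‖ = c ^ 2 * ‖curl (u s) z‖ := by
      intro z
      rw [norm_curl_slice_eq_of_isRotatedDSS h hc0 s z, ← mul_assoc, inv_pow, mul_inv_cancel₀
        (pow_ne_zero _ hc0), one_mul]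
    have hx' : d < (c ^ 2) ^ k * ‖curl (u (s / c ^ 2)) (c⁻¹ • R.symm x)‖ := by
      rw [hmag, ← mul_assoc, ← pow_succ]; exact hx
    have hy' : d < (c ^ 2) ^ k * ‖curl (u (s / c ^ 2)) (c⁻¹ • R.symm y)‖ := by
      rw [hmag, ← mul_assoc, ← pow_succ]; exact hy
    have hdist : ‖c⁻¹ • R.symm x - c⁻¹ • R.symm y‖ / c ^ k = ‖x - y‖ / c ^ (k + 1) := by
      rw [← smul_sub, ← map_sub, norm_smul, LinearIsometryEquiv.norm_map, Real.norm_eq_abs,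
        abs_of_pos (inv_pos.2 hcpos), pow_succ]
      field_simp
    have := ih (s / c ^ 2) hs' (c⁻¹ • R.symm x) (c⁻¹ • R.symm y) hx' hy'
    rwa [← unsignedDefect_eq_of_isRotatedDSS h hc0 s x y, hdist] at this

/-- **Sign-free alignment for an exactly rotated-DSS field forces `ξ(s)(x) = ± ξ(s)(y)`** at all
points of non-zero vorticity of every window slice `s ∈ (−1, 0)` (let `k → ∞` in
`sineAlignment_iterate`: the thresholds `d/c²ᵏ` are eventually passed and `η(‖x − y‖/cᵏ) → 0`).
[cite: GigaMiura2011, Theorem 1.3 and Remark 1.4 (§1; HUPS preprint #956 p. 4)] -/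
theorem vorticityDirection_eq_or_eq_neg_of_sineAlignment (h : IsRotatedDSS c R u) (hc : 1 < c)
    {d : ℝ} {η : ℝ → ℝ} (hη : Tendsto η (𝓝[>] 0) (𝓝 0))
    (hSA : ∀ s ∈ Ioo (-1 : ℝ) 0, ∀ x y, d < ‖curl (u s) x‖ → d < ‖curl (u s) y‖ →
      min ‖vorticityDirection (curl (u s)) x - vorticityDirection (curl (u s)) y‖
          ‖vorticityDirection (curl (u s)) x + vorticityDirection (curl (u s)) y‖ ≤ η ‖x - y‖)
    {s : ℝ} (hs : s ∈ Ioo (-1 : ℝ) 0) {x y : EuclideanSpace ℝ (Fin 3)} (hx : curl (u s) x ≠ 0)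
    (hy : curl (u s) y ≠ 0) :
    vorticityDirection (curl (u s)) x = vorticityDirection (curl (u s)) y ∨
      vorticityDirection (curl (u s)) x = -vorticityDirection (curl (u s)) y := by
  by_cases hxy : x = y
  · exact Or.inl (by rw [hxy])
  have hc2 : 1 < c ^ 2 := by nlinarith
  have hcpos : 0 < c := zero_lt_one.trans hc
  have hr : 0 < ‖x - y‖ := norm_pos_iff.2 (sub_ne_zero.2 hxy)
  -- thresholds are eventually passed
  have hgrow : Tendsto (fun k : ℕ => (c ^ 2) ^ k) atTop atTop :=
    tendsto_pow_atTop_atTop_of_one_lt hc2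
  have hX : ∀ᶠ k : ℕ in atTop, d < (c ^ 2) ^ k * ‖curl (u s) x‖ :=
    (hgrow.atTop_mul_const (norm_pos_iff.2 hx)).eventually_gt_atTop d
  have hY : ∀ᶠ k : ℕ in atTop, d < (c ^ 2) ^ k * ‖curl (u s) y‖ :=
    (hgrow.atTop_mul_const (norm_pos_iff.2 hy)).eventually_gt_atTop d
  -- the rescaled distances tend to `0` from the right
  have hsmall : Tendsto (fun k : ℕ => ‖x - y‖ / c ^ k) atTop (𝓝[>] 0) := by
    refine tendsto_nhdsWithin_iff.2 ⟨?_, Eventually.of_forall fun k => div_pos hr (pow_pos hcpos k)⟩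
    exact tendsto_const_nhds.div_atTop (tendsto_pow_atTop_atTop_of_one_lt hc)
  have hηk : Tendsto (fun k : ℕ => η (‖x - y‖ / c ^ k)) atTop (𝓝 0) := hη.comp hsmall
  -- the unsigned defect is below every `κ > 0`
  have hmin : min ‖vorticityDirection (curl (u s)) x - vorticityDirection (curl (u s)) y‖
      ‖vorticityDirection (curl (u s)) x + vorticityDirection (curl (u s)) y‖ ≤ 0 := by
    refine le_of_forall_pos_lt_add fun κ hκ => ?_
    rw [zero_add]
    obtain ⟨k, hk1, hk2, hk3⟩ := (hX.and (hY.and (hηk.eventually (gt_mem_nhds hκ)))).exists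
    exact (sineAlignment_iterate h hc hSA k s hs x y hk1 hk2).trans_lt hk3
  rcases min_le_iff.1 hmin with h1 | h1
  · exact Or.inl (sub_eq_zero.1 (norm_le_zero_iff.1 h1))
  · exact Or.inr (eq_neg_of_add_eq_zero_left (norm_le_zero_iff.1 h1))

/-- **Sign-free alignment for an exactly rotated-DSS field makes every window slice's vorticity
parallel to ONE LINE**: for `s ∈ (−1, 0)` there is `e` with `curl u(s)(x) = a(x) e`, `a(x) ∈ ℝ` of
any sign. [cite: BeiraodaveigaBerselli2002, Theorem 1.1 (as quoted in Lemarié-Rieusset 2016, Thm 11.7, PDF p. 369)] -/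
theorem exists_parallel_curl_of_sineAlignment (h : IsRotatedDSS c R u) (hc : 1 < c) {d : ℝ}
    {η : ℝ → ℝ} (hη : Tendsto η (𝓝[>] 0) (𝓝 0))
    (hSA : ∀ s ∈ Ioo (-1 : ℝ) 0, ∀ x y, d < ‖curl (u s) x‖ → d < ‖curl (u s) y‖ →
      min ‖vorticityDirection (curl (u s)) x - vorticityDirection (curl (u s)) y‖
          ‖vorticityDirection (curl (u s)) x + vorticityDirection (curl (u s)) y‖ ≤ η ‖x - y‖)
    {s : ℝ} (hs : s ∈ Ioo (-1 : ℝ) 0) :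
    ∃ e : EuclideanSpace ℝ (Fin 3), ∀ x, ∃ a : ℝ, curl (u s) x = a • e := by
  by_cases hz : ∀ x, curl (u s) x = 0
  · exact ⟨0, fun x => ⟨0, by rw [hz x, zero_smul]⟩⟩
  push Not at hz
  obtain ⟨x₀, hx₀⟩ := hz
  refine ⟨vorticityDirection (curl (u s)) x₀, fun x => ?_⟩
  by_cases hx : curl (u s) x = 0
  · exact ⟨0, by rw [hx, zero_smul]⟩
  rcases vorticityDirection_eq_or_eq_neg_of_sineAlignment h hc hη hSA hs hx hx₀ with h1 | h1
  · exact ⟨‖curl (u s) x‖, by rw [← h1]; exact eq_norm_smul_vorticityDirection hx⟩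
  · refine ⟨-‖curl (u s) x‖, ?_⟩
    rw [neg_smul, ← smul_neg, ← h1]
    exact eq_norm_smul_vorticityDirection hx

end Algebra

/-! ### §2 Rung profiles: a slice with line-parallel vorticity vanishes -/

variable {L : ℕ} {C₀ cmin cmax δ ε c : ℝ}
  {R : EuclideanSpace ℝ (Fin 3) ≃ₗᵢ[ℝ] EuclideanSpace ℝ (Fin 3)}
  {u : ℝ → EuclideanSpace ℝ (Fin 3) → EuclideanSpace ℝ (Fin 3)}
  {p : ℝ → EuclideanSpace ℝ (Fin 3) → ℝ}
  {d : ℝ → EuclideanSpace ℝ (Fin 3) → EuclideanSpace ℝ (Fin 3)}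

/-- **A rung-profile slice whose vorticity is everywhere parallel to one line is `≡ 0`.** The slice
`u(t)`, `t < 0`, is `C²`, divergence free and bounded by `|C₀|/√(−t)` (Type I); if
`curl u(t)(x) = a(x) e` with `e ≠ 0` it is invariant along `e` (Giga–Miura's slice lemma), if
`e = 0` it is irrotational hence constant (harmonic Liouville); either way its norm is invariant
under a non-zero translation and Type-I spatial decay kills it (KJ-47).
[cite: GigaMiura2011, Prop. 2.2, proof (§2.1; HUPS preprint #956 p. 8)] -/
theorem rungProfile_slice_eq_zero_of_parallelVorticity (hP : IsRungProfile L C₀ c R u p d)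
    {t : ℝ} (ht : t < 0) {e : EuclideanSpace ℝ (Fin 3)}
    (hpar : ∀ x, ∃ a : ℝ, curl (u t) x = a • e) : ∀ x, u t x = 0 := by
  have hC2 : ContDiff ℝ 2 (u t) :=
    (hP.classical.smooth_velocity.contDiff_slice (mem_Iio.2 ht)).of_le (by norm_cast)
  have hdiv : VectorCalculus.IsDivFree (u t) := hP.classical.divFree t (mem_Iio.2 ht)
  have hsq : 0 < Real.sqrt (-t) := Real.sqrt_pos.2 (by linarith)
  have hbdd : ∃ M : ℝ, ∀ x, ‖u t x‖ ≤ M := by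
    refine ⟨|C₀| / Real.sqrt (-t), fun x => (hP.hasTypeIDecay t ht x).trans ?_⟩
    calc C₀ / (‖x‖ + Real.sqrt (-t)) ≤ |C₀| / (‖x‖ + Real.sqrt (-t)) :=
          div_le_div_of_nonneg_right (le_abs_self _) (by positivity)
      _ ≤ |C₀| / Real.sqrt (-t) :=
          div_le_div_of_nonneg_left (abs_nonneg _) hsq (by linarith [norm_nonneg x])
  by_cases he : e = 0
  · -- irrotational slice: constant, hence translation invariant
    have hcurl : ∀ x, curl (u t) x = 0 := fun x => by
      obtain ⟨a, ha⟩ := hpar x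
      rw [ha, he, smul_zero]
    obtain ⟨M, hM⟩ := hbdd
    have hconst : ∀ x y, u t x = u t y :=
      eq_of_curl_eq_zero_of_isDivFree_of_bounded hC2 hcurl hdiv hM
    obtain ⟨b, hb⟩ := NormedSpace.exists_lt_norm ℝ (EuclideanSpace ℝ (Fin 3)) 0
    exact rungProfile_slice_eq_zero_of_screw_invariant hP (LinearIsometryEquiv.refl ℝ _) rfl
      (norm_pos_iff.1 hb) ht fun x => by simpa using congrArg (fun v => ‖v‖) (hconst (x + b) x)
  · -- curl parallel to `e ≠ 0`: invariance along `e`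
    exact rungProfile_slice_eq_zero_of_screw_invariant hP (LinearIsometryEquiv.refl ℝ _) rfl he
      ht fun x => by
        have h1 := translationInvariant_of_curl_parallel hC2 hdiv hbdd he hpar x 1
        rw [one_smul] at h1
        simpa using congrArg (fun v => ‖v‖) h1

/-- **At the level of K1's witnesses**: a rung profile all of whose slices have line-parallel
vorticity is trivial. [cite: GigaMiura2011, Prop. 2.2, proof (§2.1; HUPS preprint #956 p. 8)] -/
theorem not_nontrivial_rungProfile_of_parallelVorticity (hP : IsRungProfile L C₀ c R u p d)
    (hpar : ∀ t < 0, ∃ e : EuclideanSpace ℝ (Fin 3), ∀ x, ∃ a : ℝ, curl (u t) x = a • e) :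
    ¬ ∃ t < 0, ∃ x, u t x ≠ 0 := by
  rintro ⟨t, ht, x, hx⟩
  obtain ⟨e, he⟩ := hpar t ht
  exact hx (rungProfile_slice_eq_zero_of_parallelVorticity hP ht he x)

/-! ### §3 Window profiles -/

/-- **No window profile has line-parallel vorticity one period below the floor slice**: if the slice
`s = −1/c²` has `curl u(s)(x) = a(x) e`, it vanishes (§2), and one DSS period carries the zero
slice to `t = −1` (`u(−1, x) = R(c⁻¹ u(−1/c², c⁻¹R⁻¹x))`), against `‖u(−1, x₀)‖ ≥ δ > 0`.
[cite: ChaeWolf2017, Def. 1.1] -/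
theorem no_windowProfile_parallelVorticity_period (hδ : 0 < δ)
    (hW : IsWindowProfile L C₀ cmin cmax δ ε c R u p d) {e : EuclideanSpace ℝ (Fin 3)}
    (hpar : ∀ x, ∃ a : ℝ, curl (u (-1 / c ^ 2)) x = a • e) : False := by
  obtain ⟨hP, -, -, ⟨x₀, hx₀⟩, -⟩ := hW
  have hc : 1 < c := hP.one_lt
  have hc0 : c ≠ 0 := (zero_lt_one.trans hc).ne'
  have hs : -1 / c ^ 2 < 0 := div_neg_of_neg_of_pos (by norm_num) (by positivity)
  have hzero := rungProfile_slice_eq_zero_of_parallelVorticity hP hs hpar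
  rw [slice_eq_conj_of_isRotatedDSS hP.isRotatedDSS hc0 (-1)] at hx₀
  simp only [hzero, smul_zero, map_zero, norm_zero] at hx₀
  exact absurd hx₀ (not_le.2 hδ)

/-- **(S13) NO WINDOW PROFILE SATISFIES THE SIGN-FREE (SINE-FORM) ALIGNMENT ON THE WINDOW.**
A single window profile (`IsWindowProfile`: any rung, any window `[c_min, c_max]`, any rotation,
`δ > 0`) whose vorticity directions satisfy, on `s ∈ (−1, 0)` above SOME threshold `d₀` with SOME
modulus `η → 0` as `r ↓ 0`, `min (‖ξ(x) − ξ(y)‖) (‖ξ(x) + ξ(y)‖) ≤ η(‖x − y‖)` — implied by the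
Constantin–Fefferman / Beirão da Veiga–Berselli sine condition `|ξ(x) ∧ ξ(y)| ≤ η(‖x − y‖)/√2` —
is contradictory: the alignment self-improves to line-parallel vorticity on the slice `−1/c²` (§1),
which vanishes (§2) and kills the floor slice (§3).  No limit, no sequence.
[cite: BeiraodaveigaBerselli2002, Theorem 1.1 (as quoted in Lemarié-Rieusset 2016, Thm 11.7, PDF p. 369)] -/
theorem no_windowProfile_sineAlignment (hδ : 0 < δ)
    (hW : IsWindowProfile L C₀ cmin cmax δ ε c R u p d) {d₀ : ℝ} {η : ℝ → ℝ}
    (hη : Tendsto η (𝓝[>] 0) (𝓝 0))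
    (hSA : ∀ s ∈ Ioo (-1 : ℝ) 0, ∀ x y, d₀ < ‖curl (u s) x‖ → d₀ < ‖curl (u s) y‖ →
      min ‖vorticityDirection (curl (u s)) x - vorticityDirection (curl (u s)) y‖
          ‖vorticityDirection (curl (u s)) x + vorticityDirection (curl (u s)) y‖ ≤ η ‖x - y‖) :
    False := by
  have hc : 1 < c := hW.isRungProfile.one_lt
  have hs : -1 / c ^ 2 ∈ Ioo (-1 : ℝ) 0 := by
    have hc2 : 1 < c ^ 2 := by nlinarith
    refine ⟨?_, div_neg_of_neg_of_pos (by norm_num) (by positivity)⟩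
    rw [lt_div_iff₀ (by positivity)]
    nlinarith
  obtain ⟨e, hpar⟩ :=
    exists_parallel_curl_of_sineAlignment hW.isRungProfile.isRotatedDSS hc hη hSA hs
  exact no_windowProfile_parallelVorticity_period hδ hW hpar

/-- **The signed Giga–Miura (CA) for ONE window profile is contradictory** (special case of
`no_windowProfile_sineAlignment`, since `‖ξ(x) − ξ(y)‖` dominates the unsigned defect; KJ-46's
`no_windowSequence_continuousAlignment` needed the whole window sequence and the ladder limit).
[cite: GigaMiura2011, Theorem 1.3 and Remark 1.4 (§1; HUPS preprint #956 p. 4)] -/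
theorem no_windowProfile_continuousAlignment (hδ : 0 < δ)
    (hW : IsWindowProfile L C₀ cmin cmax δ ε c R u p d) {d₀ : ℝ} {η : ℝ → ℝ}
    (hη : Tendsto η (𝓝[>] 0) (𝓝 0))
    (hCA : ∀ s ∈ Ioo (-1 : ℝ) 0, ∀ x y, d₀ < ‖curl (u s) x‖ → d₀ < ‖curl (u s) y‖ →
      ‖vorticityDirection (curl (u s)) x - vorticityDirection (curl (u s)) y‖ ≤ η ‖x - y‖) :
    False :=
  no_windowProfile_sineAlignment hδ hW hη fun s hs x y hx hy =>
    (min_le_left _ _).trans (hCA s hs x y hx hy)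

/-! ### §4 The K1 ∧ K2 reading -/

/-- **K1 ∧ (K2 supplied by window profiles with sign-free aligned vorticity directions) is
contradictory** — at the FIRST singular rung past `L₀`; threshold and modulus may depend on the
rung. [cite: BeiraodaveigaBerselli2002, Theorem 1.1 (as quoted in Lemarié-Rieusset 2016, Thm 11.7, PDF p. 369)] -/
theorem not_cofinal_and_noOverheating_sineAlignment (C₀ : ℝ) :
    ¬ (RungBlowupCofinal ∧ ∃ (cmin cmax δ : ℝ) (L₀ : ℕ) (ε : ℕ → ℝ), 1 < cmin ∧ 0 < δ ∧
        Tendsto ε atTop (𝓝 0) ∧ ∀ L ≥ L₀, RungIsSingular L →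
          ∃ (c : ℝ) (R : EuclideanSpace ℝ (Fin 3) ≃ₗᵢ[ℝ] EuclideanSpace ℝ (Fin 3))
            (u : ℝ → EuclideanSpace ℝ (Fin 3) → EuclideanSpace ℝ (Fin 3))
            (p : ℝ → EuclideanSpace ℝ (Fin 3) → ℝ)
            (d : ℝ → EuclideanSpace ℝ (Fin 3) → EuclideanSpace ℝ (Fin 3)),
            IsWindowProfile L C₀ cmin cmax δ (ε L) c R u p d ∧
              ∃ (d₀ : ℝ) (η : ℝ → ℝ), Tendsto η (𝓝[>] 0) (𝓝 0) ∧
                ∀ s ∈ Ioo (-1 : ℝ) 0, ∀ x y, d₀ < ‖curl (u s) x‖ → d₀ < ‖curl (u s) y‖ →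
                  min ‖vorticityDirection (curl (u s)) x - vorticityDirection (curl (u s)) y‖
                      ‖vorticityDirection (curl (u s)) x + vorticityDirection (curl (u s)) y‖ ≤
                    η ‖x - y‖) := by
  rintro ⟨h₁, cmin, cmax, δ, L₀, ε, -, hδ, -, hwin⟩
  obtain ⟨L, hL, hsing⟩ := h₁ L₀
  obtain ⟨c, R, u, p, d, hW, d₀, η, hη, hSA⟩ := hwin L hL hsing
  exact no_windowProfile_sineAlignment hδ hW hη hSA

/-- Supply form: a K2 met by window profiles with sign-free aligned vorticity directions refutes K1.
[cite: BeiraodaveigaBerselli2002, Theorem 1.1 (as quoted in Lemarié-Rieusset 2016, Thm 11.7, PDF p. 369)] -/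
theorem rungBlowupCofinal_false_of_noOverheating_sineAlignment (C₀ : ℝ)
    (h : ∃ (cmin cmax δ : ℝ) (L₀ : ℕ) (ε : ℕ → ℝ), 1 < cmin ∧ 0 < δ ∧
        Tendsto ε atTop (𝓝 0) ∧ ∀ L ≥ L₀, RungIsSingular L →
          ∃ (c : ℝ) (R : EuclideanSpace ℝ (Fin 3) ≃ₗᵢ[ℝ] EuclideanSpace ℝ (Fin 3))
            (u : ℝ → EuclideanSpace ℝ (Fin 3) → EuclideanSpace ℝ (Fin 3))
            (p : ℝ → EuclideanSpace ℝ (Fin 3) → ℝ)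
            (d : ℝ → EuclideanSpace ℝ (Fin 3) → EuclideanSpace ℝ (Fin 3)),
            IsWindowProfile L C₀ cmin cmax δ (ε L) c R u p d ∧
              ∃ (d₀ : ℝ) (η : ℝ → ℝ), Tendsto η (𝓝[>] 0) (𝓝 0) ∧
                ∀ s ∈ Ioo (-1 : ℝ) 0, ∀ x y, d₀ < ‖curl (u s) x‖ → d₀ < ‖curl (u s) y‖ →
                  min ‖vorticityDirection (curl (u s)) x - vorticityDirection (curl (u s)) y‖
                      ‖vorticityDirection (curl (u s)) x + vorticityDirection (curl (u s)) y‖ ≤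
                    η ‖x - y‖) :
    ¬ RungBlowupCofinal := fun h₁ =>
  not_cofinal_and_noOverheating_sineAlignment C₀ ⟨h₁, h⟩

end Summit.NavierStokesRegularity.AngularGalerkinLadderSineFormAlignmentExcluded

end
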